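import Summits.ValiantsHypothesis.ValiantsHypothesis.Theorems.KPlusLogSqLawTropicalBThinLogCycles

/-!
# Route «KPlusLogSqLaw», crux `TropicalB` (stmt-ValiantsHypothesis-19771) — THE FAT STUB'S INEQUALITY FOR CHAINS WITH CYCLES OF `≤ K/⌊log₂ m⌋` COLUMNS:
# `K ≤ m`, every exchange cycle of `≤ K/⌊log₂ m⌋` columns ⇒ `n ≤ 2^(8K)`, in EVERY design

HONEST FRAMING.  Helper toward the registered stubs `stub_tropFat` (`∃ C, ∀ m K, ⌊log₂ m⌋² ≤ K → TropRow m K (2^(C·K))`) and `stub_tropThin` of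
`Cruxes/TropicalB/Lines/birth.lean` (crux `Summit.ValiantsHypothesis.ValiantsHypothesis.Theses.KPlusLogSqLaw.TropicalB`, item stmt-ValiantsHypothesis-19771, route
KPlusLogSqLaw; cell `pub-symmetroid`, seat val-sym-trop-p1 g25, 2026-08-29; `--supports … --as helper`).  The fat-window twin of `…TropicalBThinLogCycles`: a
SECTOR theorem for ARBITRARY designs and exponents inside the window `K ≤ m` (at `m ≤ K` the stub is the tree's `tropRow_offWindow`); the stubs and `TropicalB`
stay OPEN; nothing here bears on `WeakLifting`, DoorA26 / DoorA34, `MatrixDescartes` (stmt-ValiantsHypothesis-18050) or VP ≠ VNP.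

* `fat_arith` — for `L = ⌊log₂ m⌋`, `K ≤ m` and `c = K / L` (natural division; `c = 0` if `L = 0`): `(c+1)·(m²(K+c) + 1)^c ≤ 2^(8K)`.
* **`chain_le_fat_shortCycles_of_exceptions`** / **`chain_le_fat_shortCycles`** / `_alt` — `K ≤ m` ⇒ every unsigned dominant chain has
  `n ≤ #J + 2^(8K)` for every `J` outside which all orbits of the exchange quotients have `≤ K/⌊log₂ m⌋` columns; with `J = ∅`: the fat stub's inequality
  with `C = 8` for every chain whose exchange cycles have at most `K/⌊log₂ m⌋` columns (by the LOCAL PATTERN LAW `chain_le_localPattern` + `sum_sites_le`).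
READING.  Together with the thin twin: inside the window a counterexample to `TropicalB` must make super-many exchanges along cycles of more than
`max(⌊log₂ m⌋, K/⌊log₂ m⌋)` columns — `2^{ω(log² m)}` of them in the thin regime, `2^{ω(K)}` in the fat regime.
[this cell's law + arithmetic]
-/

set_option linter.dupNamespace false
set_option autoImplicit false

namespace Summit.ValiantsHypothesis.ValiantsHypothesis.Theorems.KPlusLogSqLaw

open Summit.ValiantsHypothesis.ValiantsHypothesis.Theorems.MatrixDescartes.Negative
open scoped BigOperators
open Finset

namespace LocalPattern

/-- **Fat-window arithmetic**: for `L = ⌊log₂ m⌋`, `K ≤ m` and `c = K / L`, `(c+1)·(m²(K+c) + 1)^c ≤ 2^(8K)`. [arithmetic] -/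
theorem fat_arith (m K : ℕ) (hKm : K ≤ m) :
    (K / Nat.log 2 m + 1) * (m ^ 2 * (K + K / Nat.log 2 m) + 1) ^ (K / Nat.log 2 m) ≤ 2 ^ (8 * K) := by
  set L := Nat.log 2 m with hLdef
  set c := K / L with hc
  have hm : m < 2 ^ (L + 1) := Nat.lt_pow_succ_log_self (by norm_num) m
  have hcK : c ≤ K := Nat.div_le_self K L
  have hcL : c * L ≤ K := Nat.div_mul_le_self K L
  -- `c + 1 ≤ 2^c`, `m² ≤ 2^(2L+2)`, `K + c ≤ 2^(L+2) − 2`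
  have hc1 : c + 1 ≤ 2 ^ c := Nat.lt_two_pow_self
  have hm2 : m ^ 2 ≤ 2 ^ (2 * L + 2) := by
    calc m ^ 2 ≤ (2 ^ (L + 1)) ^ 2 := Nat.pow_le_pow_left hm.le 2
      _ = 2 ^ (2 * L + 2) := by rw [← pow_mul]; ring_nf
  have hKc : K + c + 1 ≤ 2 ^ (L + 2) := by
    have : 2 ^ (L + 2) = 2 * 2 ^ (L + 1) := by rw [pow_succ]; ring
    omega
  have hbase : m ^ 2 * (K + c) + 1 ≤ 2 ^ (3 * L + 4) := by
    have h1 : m ^ 2 * (K + c) + 1 ≤ 2 ^ (2 * L + 2) * (K + c) + 1 := by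
      have := Nat.mul_le_mul_right (K + c) hm2; omega
    have h2 : 2 ^ (2 * L + 2) * (K + c) + 1 ≤ 2 ^ (2 * L + 2) * (K + c + 1) := by
      have := Nat.one_le_two_pow (n := 2 * L + 2); nlinarith
    have h3 : 2 ^ (2 * L + 2) * (K + c + 1) ≤ 2 ^ (2 * L + 2) * 2 ^ (L + 2) := Nat.mul_le_mul_left _ hKc
    have h4 : 2 ^ (2 * L + 2) * 2 ^ (L + 2) = 2 ^ (3 * L + 4) := by rw [← pow_add]; ring_nf
    omega
  have hexp : (3 * L + 4) * c ≤ 7 * K := by nlinarith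
  calc (c + 1) * (m ^ 2 * (K + c) + 1) ^ c ≤ 2 ^ c * (2 ^ (3 * L + 4)) ^ c := Nat.mul_le_mul hc1 (Nat.pow_le_pow_left hbase c)
    _ = 2 ^ (c + (3 * L + 4) * c) := by rw [← pow_mul, ← pow_add]
    _ ≤ 2 ^ (8 * K) := Nat.pow_le_pow_right (by norm_num) (by omega)

variable {m K : ℕ} (d : Fin K → ℕ) (v ε : Fin m → Fin m → Fin K → ℤ)

/-- **FAT STUB FOR SHORT-CYCLE CHAINS, with exceptions.**  If `K ≤ m`, then in every design of format `(m, K)` every chain of terms dominant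
at strictly increasing slopes with consecutive terms distinct has `n ≤ #J + 2^(8K)` for every set `J` of steps outside which every column lies in an
invariant set of at most `K / ⌊log₂ m⌋` columns of the exchange quotient. [this cell's law] -/
theorem chain_le_fat_shortCycles_of_exceptions (hKm : K ≤ m) {n : ℕ} (θ : Fin (n + 1) → ℤ)
    (p : Fin (n + 1) → Equiv.Perm (Fin m) × (Fin m → Fin K))
    (hθ : StrictMono θ) (hdom : ∀ k, IsDominant d v ε (θ k) (p k)) (hne : ∀ k : Fin n, p k.castSucc ≠ p k.succ)
    (J : Finset (Fin n))
    (horb : ∀ k : Fin n, k ∉ J → ∀ b : Fin m, ∃ T : Finset (Fin m), b ∈ T ∧ T.card ≤ K / Nat.log 2 m ∧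
      ∀ x, ((p k.castSucc).1⁻¹ * (p k.succ).1) x ∈ T ↔ x ∈ T) :
    n ≤ J.card + 2 ^ (8 * K) := by
  have hlaw := chain_le_localPattern d v ε (K / Nat.log 2 m) θ p hθ hdom hne J horb
  have h := (sum_sites_le m K (K / Nat.log 2 m)).trans (fat_arith m K hKm)
  omega

/-- **THE FAT STUB'S INEQUALITY FOR CHAINS WITH CYCLES OF `≤ K/⌊log₂ m⌋` COLUMNS** (`C = 8`, unsigned, every design): if `K ≤ m` and every
exchange quotient of the chain has all orbits of at most `K / ⌊log₂ m⌋` columns, then `n ≤ 2^(8K)`. [this cell's law] -/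
theorem chain_le_fat_shortCycles (hKm : K ≤ m) {n : ℕ} (θ : Fin (n + 1) → ℤ)
    (p : Fin (n + 1) → Equiv.Perm (Fin m) × (Fin m → Fin K))
    (hθ : StrictMono θ) (hdom : ∀ k, IsDominant d v ε (θ k) (p k)) (hne : ∀ k : Fin n, p k.castSucc ≠ p k.succ)
    (horb : ∀ k : Fin n, ∀ b : Fin m, ∃ T : Finset (Fin m), b ∈ T ∧ T.card ≤ K / Nat.log 2 m ∧
      ∀ x, ((p k.castSucc).1⁻¹ * (p k.succ).1) x ∈ T ↔ x ∈ T) :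
    n ≤ 2 ^ (8 * K) := by
  have h := chain_le_fat_shortCycles_of_exceptions d v ε hKm θ p hθ hdom hne ∅ (fun k _ b => horb k b)
  simpa using h

/-- **Sign-alternating form.** [this cell's law] -/
theorem chain_le_fat_shortCycles_alt (hKm : K ≤ m) {n : ℕ} (θ : Fin (n + 1) → ℤ)
    (p : Fin (n + 1) → Equiv.Perm (Fin m) × (Fin m → Fin K))
    (hθ : StrictMono θ) (hdom : ∀ k, IsDominant d v ε (θ k) (p k))
    (halt : ∀ k : Fin n, termSign ε (p k.castSucc) * termSign ε (p k.succ) < 0)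
    (horb : ∀ k : Fin n, ∀ b : Fin m, ∃ T : Finset (Fin m), b ∈ T ∧ T.card ≤ K / Nat.log 2 m ∧
      ∀ x, ((p k.castSucc).1⁻¹ * (p k.succ).1) x ∈ T ↔ x ∈ T) :
    n ≤ 2 ^ (8 * K) :=
  chain_le_fat_shortCycles d v ε hKm θ p hθ hdom (ne_succ_of_alternating ε p halt) horb

end LocalPattern

end Summit.ValiantsHypothesis.ValiantsHypothesis.Theorems.KPlusLogSqLaw
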